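import Summits.HodgeConjecture.CorCM.MultiFieldWeilThreePerFieldFamilies
import Summits.HodgeConjecture.CorCM.CMAbelianFactorsDimLeThreeClassification
import Summits.HodgeConjecture.CorCM.MultiFieldWeilSeparatedThreefoldFactorsWitnessed
import HarnessLib

/-!
# MULTI-FIELD WEIL ENGINE — ON THE VARIETY, THREE PER FIELD: a complex abelian variety of CM type with simple isogeny factors of dimension `≤ 3` whose non-isogenous
# THREEFOLD factors sharing an imaginary quadratic field have CM fields with different Galois closures, with at most THREE isogeny classes of threefold factors per
# isomorphism class of sextic CM fields and no dihedral surface triple, satisfies the Hodge conjecture with everything dominated by its powers — given ONLY Markman 4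

Cell `pub-hodgecm2` (COR-CM), seat b30 gen 36 (2026-08-25); count-neutral own lane MULTI-FIELD WEIL ENGINE (stem `MultiFieldWeil*`) — the INTRINSIC form of
`CorCM/MultiFieldWeilThreePerFieldFamilies.lean` read on the variety through Milne's regrouping, in the pattern of `CorCM/MultiFieldWeilNoClosureTripleFactors.lean` whose
hypothesis «no three threefold factors in one Galois closure» is here REPLACED by seat b16's census bound «at most three isogeny classes of threefold factors with isomorphic CM
fields» (four carry a genuinely exceptional class, seat p2).  Theorems only; no definition, no named fact, no `sorry`.  HONEST FRAMING: conditional on the displayed Markman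
fourfold binder only; `HC_CM` is NOT proved and not asserted — a statement about a NAMED CLASS of CM abelian varieties.

THE STATEMENT (**`hodgeConjectureFor_of_avDominatedBy_powSucc_of_isOfCMType_of_threePerField_of_markman`**).  Let `X` be a complex abelian variety of CM type such that
(a) every simple isogeny factor has dimension `≤ 3`; (b) for any two NON-isogenous simple threefold factors `B₀ ⊨ (K₀; Φ₀)`, `B₁ ⊨ (K₁; Φ₁)` (all CM realisations): if a
totally complex quadratic subfield of `K₀` embeds in `K₁` then the Galois closures of `K₀`, `K₁` differ (for fields `k·F` this is, in truth, «`K₀ ≄ K₁`»); (b″) no FOUR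
pairwise non-isogenous simple threefold factors have pairwise isomorphic CM fields; (c) no three pairwise non-isogenous simple surface factors have CM fields sharing one
Galois closure.  Then EVERY complex abelian variety dominated by a power `X^{N+1}` satisfies the Hodge conjecture, GIVEN ONLY `Markman2025_weilClasses_algebraic_abelianFourfold`.
Compare seat b16's UNCONDITIONAL classification (`CorCM/CMAbelianFactorsDimLeThreeClassification`): all powers are divisor-generated iff (i′) no imaginary quadratic field is shared
by two non-isogenous factors, (ii′) at most three threefold classes per endomorphism field, (iii′) no dihedral surface triple — here (i′) is RELAXED to (b) at the price of Markman's
theorem: threefold factors MAY share imaginary quadratic fields (the Weil-type world) as long as those sharing one have different closures.  §2: the WITNESSED form.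

HONEST LIMITS: non-isogenous threefold factors through one imaginary quadratic field with EQUAL closures (isomorphic fields `k·F` with different types: b16's (ii′) proper);
four classes of one field; the dihedral surface triple; simple factors of dimension `≥ 4`.

[cite: MoonenZarhin1999LowDim, Thm. (0.1), Thm. (0.2), §3 (3.1), Cor. (3.9), §5 (5.2)] [cite: Markman2025SurveySecant, Thm. 1.2] [cite: Milne1999LefschetzClasses, §1 Prop. 1.1]
[cite: MilneCM2006, Ch. I Prop. 3.13] [cite: Dodson1984, §5.1.2 Theorem] [cite: MumfordAV1970, §19 Thm. 1, Cor. 1–2 and p. 169] [cite: Gordon1999HodgeAVSurvey, §3 Theorem (proof), 7.4–7.7, 9.4]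
-/

noncomputable section

open CategoryTheory CategoryTheory.Limits NumberField IntermediateField

namespace Summit.HodgeConjecture.CorCM.MultiFieldWeil

open Literature.AlgebraicGeometry Literature.AlgebraicGeometry.Motives Literature.AlgebraicGeometry.HodgeTheory
open Literature.AlgebraicGeometry.Motives.AbelianVariety
open Literature.AlgebraicGeometry.ComplexMultiplication (IsCMTypeRealisation exists_ringEquiv_forall_mem_iff_of_isIsogenous)
open Literature.AlgebraicTopology.SingularHomology
open Literature.NumberTheory.ComplexMultiplication
open Literature.AlgebraicGeometry.Milne1999 (IsOfCMType)
open Summit.HodgeConjecture.CorCM.Domination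

open scoped Classical

section OnTheVariety

variable {X : AbelianVariety ℂ}

/-- Powers of a zero-dimensional abelian variety are zero-dimensional. [folklore] -/
private theorem dim_powSucc_eq_zero₃₆u (h0 : X.dim = 0) : ∀ N : ℕ, (X.powSucc N).dim = 0
  | 0 => h0
  | N + 1 => by rw [powSucc_succ, dim_prod, dim_powSucc_eq_zero₃₆u h0 N, h0]

/-- **MAIN THEOREM (on the variety) — THREEFOLD FACTORS SHARING AN IMAGINARY QUADRATIC FIELD HAVE NON-ISOMORPHIC CM FIELDS; AT MOST THREE THREEFOLD FACTORS PER
FIELD; NO DIHEDRAL SURFACE TRIPLE; ANY ELLIPTIC FACTORS — given ONLY Markman's fourfold theorem.**  `X` of CM type; (a) simple isogeny factors of dimension `≤ 3`; (b) for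
any two non-isogenous simple threefold factors and all CM realisations `B₀ ⊨ (K₀; Φ₀)`, `B₁ ⊨ (K₁; Φ₁)`: a totally complex quadratic `F ≤ K₀` embedding in `K₁` forces
`L(K₀) ≠ L(K₁)`; (b″) no four pairwise non-isogenous simple threefold factors with pairwise isomorphic CM fields (all realisations); (c) no three pairwise non-isogenous simple
surface factors with CM realisations sharing one Galois closure.  Then everything dominated by a power `X^{N+1}` satisfies the Hodge conjecture, GIVEN ONLY
`Markman2025_weilClasses_algebraic_abelianFourfold`.  `HC_CM` is NOT asserted.
[cite: Milne1999LefschetzClasses, §1 Prop. 1.1] [cite: MoonenZarhin1999LowDim, Thm. (0.1), (0.2), §3 (3.1), Cor. (3.9)] [cite: Markman2025SurveySecant, Thm. 1.2]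
[cite: Dodson1984, §5.1.2 Theorem] [cite: MumfordAV1970, §19 Thm. 1, Cor. 1–2] -/
theorem hodgeConjectureFor_of_avDominatedBy_powSucc_of_isOfCMType_of_threePerField_of_markman
    (hW4 : Markman2025_weilClasses_algebraic_abelianFourfold) (hcm : IsOfCMType X)
    (h3 : ∀ B : AbelianVariety ℂ, B.IsSimple → AVDominatedBy B X → B.dim ≤ 3)
    (hT : ∀ B₀ B₁ : AbelianVariety ℂ, B₀.IsSimple → B₁.IsSimple → AVDominatedBy B₀ X → AVDominatedBy B₁ X → B₀.dim = 3 → B₁.dim = 3 → ¬ IsIsogenous B₀ B₁ →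
      ∀ (K₀ : Type) [Field K₀] [NumberField K₀] [IsCMField K₀] (Φ₀ : CMType K₀) (ι₀ : 𝓞 K₀ →+* End B₀) (θ₀ : K₀ →+* Module.End ℂ (complexBetti B₀.X 1))
        (K₁ : Type) [Field K₁] [NumberField K₁] [IsCMField K₁] (Φ₁ : CMType K₁) (ι₁ : 𝓞 K₁ →+* End B₁) (θ₁ : K₁ →+* Module.End ℂ (complexBetti B₁.X 1)),
        IsCMTypeRealisation Φ₀ B₀ ι₀ θ₀ → IsCMTypeRealisation Φ₁ B₁ ι₁ θ₁ →
          ((∃ F : IntermediateField ℚ K₀, Module.finrank ℚ F = 2 ∧ IsTotallyComplex F ∧ Nonempty (F →+* K₁)) → normalClosure ℚ K₀ ℂ ≠ normalClosure ℚ K₁ ℂ))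
    (hT4 : ∀ B₀ B₁ B₂ B₃ : AbelianVariety ℂ, B₀.IsSimple → B₁.IsSimple → B₂.IsSimple → B₃.IsSimple →
      AVDominatedBy B₀ X → AVDominatedBy B₁ X → AVDominatedBy B₂ X → AVDominatedBy B₃ X → B₀.dim = 3 → B₁.dim = 3 → B₂.dim = 3 → B₃.dim = 3 →
      ¬ IsIsogenous B₀ B₁ → ¬ IsIsogenous B₀ B₂ → ¬ IsIsogenous B₀ B₃ → ¬ IsIsogenous B₁ B₂ → ¬ IsIsogenous B₁ B₃ → ¬ IsIsogenous B₂ B₃ →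
      ∀ (K₀ : Type) [Field K₀] [NumberField K₀] [IsCMField K₀] (Φ₀ : CMType K₀) (ι₀ : 𝓞 K₀ →+* End B₀) (θ₀ : K₀ →+* Module.End ℂ (complexBetti B₀.X 1))
        (K₁ : Type) [Field K₁] [NumberField K₁] [IsCMField K₁] (Φ₁ : CMType K₁) (ι₁ : 𝓞 K₁ →+* End B₁) (θ₁ : K₁ →+* Module.End ℂ (complexBetti B₁.X 1))
        (K₂ : Type) [Field K₂] [NumberField K₂] [IsCMField K₂] (Φ₂ : CMType K₂) (ι₂ : 𝓞 K₂ →+* End B₂) (θ₂ : K₂ →+* Module.End ℂ (complexBetti B₂.X 1))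
        (K₃ : Type) [Field K₃] [NumberField K₃] [IsCMField K₃] (Φ₃ : CMType K₃) (ι₃ : 𝓞 K₃ →+* End B₃) (θ₃ : K₃ →+* Module.End ℂ (complexBetti B₃.X 1)),
        IsCMTypeRealisation Φ₀ B₀ ι₀ θ₀ → IsCMTypeRealisation Φ₁ B₁ ι₁ θ₁ → IsCMTypeRealisation Φ₂ B₂ ι₂ θ₂ → IsCMTypeRealisation Φ₃ B₃ ι₃ θ₃ →
          ¬ (Nonempty (K₁ ≃+* K₀) ∧ Nonempty (K₂ ≃+* K₀) ∧ Nonempty (K₃ ≃+* K₀)))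
    (hS : ∀ B₀ B₁ B₂ : AbelianVariety ℂ, B₀.IsSimple → B₁.IsSimple → B₂.IsSimple → AVDominatedBy B₀ X → AVDominatedBy B₁ X → AVDominatedBy B₂ X →
      B₀.dim = 2 → B₁.dim = 2 → B₂.dim = 2 → ¬ IsIsogenous B₀ B₁ → ¬ IsIsogenous B₀ B₂ → ¬ IsIsogenous B₁ B₂ →
      ∀ (K₀ : Type) [Field K₀] [NumberField K₀] [IsCMField K₀] (Φ₀ : CMType K₀) (ι₀ : 𝓞 K₀ →+* End B₀) (θ₀ : K₀ →+* Module.End ℂ (complexBetti B₀.X 1))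
        (K₁ : Type) [Field K₁] [NumberField K₁] [IsCMField K₁] (Φ₁ : CMType K₁) (ι₁ : 𝓞 K₁ →+* End B₁) (θ₁ : K₁ →+* Module.End ℂ (complexBetti B₁.X 1))
        (K₂ : Type) [Field K₂] [NumberField K₂] [IsCMField K₂] (Φ₂ : CMType K₂) (ι₂ : 𝓞 K₂ →+* End B₂) (θ₂ : K₂ →+* Module.End ℂ (complexBetti B₂.X 1)),
        IsCMTypeRealisation Φ₀ B₀ ι₀ θ₀ → IsCMTypeRealisation Φ₁ B₁ ι₁ θ₁ → IsCMTypeRealisation Φ₂ B₂ ι₂ θ₂ →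
          ¬ (normalClosure ℚ K₀ ℂ = normalClosure ℚ K₁ ℂ ∧ normalClosure ℚ K₁ ℂ = normalClosure ℚ K₂ ℂ))
    {B : AbelianVariety ℂ} {N : ℕ} (hB : AVDominatedBy B (X.powSucc N)) : HodgeConjectureFor B.dim B.X := by
  rcases Nat.eq_zero_or_pos X.dim with h0 | hX0
  · exact hodgeConjectureFor_of_isDivisorGenerated _ (isDivisorGenerated_of_avDominatedBy hB
      (Literature.AlgebraicGeometry.Pohlmann1968.isDivisorGenerated_of_dim_eq_zero _ (dim_powSucc_eq_zero₃₆u h0 N)))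
  -- Milne's regrouping: `X ∼ ⨁_i A'_{cls i}`, `A'_c` simple, pairwise non-isogenous, CM-realised
  obtain ⟨C, _, K', _, _, _, Φ', A', ι', θ', m, cls, f, hA, hs, hniso, hcls, hf⟩ := exists_isIsogeny_biproduct_of_isSimple_of_isOfCMType (X := X) hX0 hcm
  have hXP : AVDominatedBy X (⨁ fun i => A' (cls i)) := AVDominatedBy.of_isIsogeny_hom hf (AVDominatedBy.refl _)
  have hPX : AVDominatedBy (⨁ fun i => A' (cls i)) X := AVDominatedBy.of_isIsogeny_inv hf (AVDominatedBy.refl _)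
  have hslot : ∀ c, AVDominatedBy (A' c) X := fun c => by
    obtain ⟨i, rfl⟩ := hcls c
    exact (avDominatedBy_biproduct_summand (fun i => A' (cls i)) i).trans hPX
  have hdim3 : ∀ c, (A' c).dim ≤ 3 := fun c => h3 _ (hs c) (hslot c)
  have hfin : ∀ c, Module.finrank ℚ (K' c) = 2 * (A' c).dim := fun c =>
    Literature.AlgebraicGeometry.Pohlmann1968.finrank_eq_two_mul_dim_of_isCMTypeRealisation (hA c)
  -- (b) on the sextic slots: sharing forces different closures
  have hQ : ∀ t t' : C, t ≠ t' → Module.finrank ℚ (K' t) = 6 → Module.finrank ℚ (K' t') = 6 →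
      (∃ F : IntermediateField ℚ (K' t), Module.finrank ℚ F = 2 ∧ IsTotallyComplex F ∧ Nonempty (F →+* K' t')) →
        normalClosure ℚ (K' t) ℂ ≠ normalClosure ℚ (K' t') ℂ := fun t t' hne ht ht' =>
    hT (A' t) (A' t') (hs t) (hs t') (hslot t) (hslot t') (by have := hfin t; omega) (by have := hfin t'; omega) (hniso t t' hne)
      (K' t) (Φ' t) (ι' t) (θ' t) (K' t') (Φ' t') (ι' t') (θ' t') (hA t) (hA t')
  -- pairwise non-isogeny of the slots, and (b″) at most three per isomorphism class
  have hN : ∀ t t' : C, t ≠ t' → Module.finrank ℚ (K' t) = 6 → Module.finrank ℚ (K' t') = 6 → ¬ IsIsogenous (A' t) (A' t') := fun t t' h _ _ => hniso t t' h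
  have hB3 : ∀ t : C, Module.finrank ℚ (K' t) = 6 → (Finset.univ.filter fun t' => Nonempty (K' t' ≃+* K' t)).card ≤ 3 := by
    intro t ht
    by_contra hlt
    push Not at hlt
    obtain ⟨d, hd, hdm⟩ := exists_injective_fin_of_le_card (s := Finset.univ.filter fun t' => Nonempty (K' t' ≃+* K' t)) (n := 4) hlt
    have hiso : ∀ x, Nonempty (K' (d x) ≃+* K' t) := fun x => (Finset.mem_filter.1 (hdm x)).2
    have h6d : ∀ x, Module.finrank ℚ (K' (d x)) = 6 := fun x => by
      obtain ⟨e⟩ := hiso x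
      rw [← ht]; exact (AlgEquiv.ofRingEquiv (f := e) fun q => map_ratCast e q).toLinearEquiv.finrank_eq
    have hne : ∀ x y : Fin 4, x ≠ y → d x ≠ d y := fun x y h h' => h (hd h')
    have hcomp : ∀ x, Nonempty (K' (d x) ≃+* K' (d 0)) := fun x => by
      obtain ⟨e⟩ := hiso x; obtain ⟨e₀⟩ := hiso 0; exact ⟨e.trans e₀.symm⟩
    exact hT4 (A' (d 0)) (A' (d 1)) (A' (d 2)) (A' (d 3)) (hs _) (hs _) (hs _) (hs _) (hslot _) (hslot _) (hslot _) (hslot _)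
      (by have := hfin (d 0); have := h6d 0; omega) (by have := hfin (d 1); have := h6d 1; omega) (by have := hfin (d 2); have := h6d 2; omega)
      (by have := hfin (d 3); have := h6d 3; omega)
      (hniso _ _ (hne 0 1 (by decide))) (hniso _ _ (hne 0 2 (by decide))) (hniso _ _ (hne 0 3 (by decide))) (hniso _ _ (hne 1 2 (by decide)))
      (hniso _ _ (hne 1 3 (by decide))) (hniso _ _ (hne 2 3 (by decide)))
      (K' (d 0)) (Φ' (d 0)) (ι' (d 0)) (θ' (d 0)) (K' (d 1)) (Φ' (d 1)) (ι' (d 1)) (θ' (d 1)) (K' (d 2)) (Φ' (d 2)) (ι' (d 2)) (θ' (d 2)) (K' (d 3)) (Φ' (d 3)) (ι' (d 3)) (θ' (d 3))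
      (hA _) (hA _) (hA _) (hA _) ⟨hcomp 1, hcomp 2, hcomp 3⟩
  -- (c) on the quartic slots
  have hS3 : ∀ i j l : C, Module.finrank ℚ (K' i) = 4 → Module.finrank ℚ (K' j) = 4 → Module.finrank ℚ (K' l) = 4 →
      normalClosure ℚ (K' i) ℂ = normalClosure ℚ (K' j) ℂ → normalClosure ℚ (K' j) ℂ = normalClosure ℚ (K' l) ℂ →
      IsIsogenous (A' i) (A' j) ∨ IsIsogenous (A' i) (A' l) ∨ IsIsogenous (A' j) (A' l) := by
    intro i j l hi hj hl hLij hLjl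
    by_cases hij : i = j
    · subst hij
      exact Or.inl (IsIsogenous.refl _)
    by_cases hil : i = l
    · subst hil
      exact Or.inr (Or.inl (IsIsogenous.refl _))
    by_cases hjl : j = l
    · subst hjl
      exact Or.inr (Or.inr (IsIsogenous.refl _))
    exact absurd ⟨hLij, hLjl⟩ (hS (A' i) (A' j) (A' l) (hs i) (hs j) (hs l) (hslot i) (hslot j) (hslot l) (by have := hfin i; omega)
      (by have := hfin j; omega) (by have := hfin l; omega) (hniso i j hij) (hniso i l hil) (hniso j l hjl)
      (K' i) (Φ' i) (ι' i) (θ' i) (K' j) (Φ' j) (ι' j) (θ' j) (K' l) (Φ' l) (ι' l) (θ' l) (hA i) (hA j) (hA l))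
  -- every power of `X` is dominated by a product of copies of the slots
  obtain ⟨n, π, hdom⟩ := exists_avDominatedBy_powSucc_biproduct_slots A' cls hXP N
  exact hodgeConjectureFor_of_avDominatedBy_prod_of_threePerField_of_markman (I := C) hW4 hA hs hdim3 hQ hN hB3 hS3 π (hB.trans hdom)

/-- **The Hodge conjecture for `X` itself and all its powers**, under (a), (b), (b″), (c), given only Markman's fourfold theorem. [cite: MoonenZarhin1999LowDim, Thm. (0.1), (0.2)]
[cite: Markman2025SurveySecant, Thm. 1.2] -/
theorem hodgeConjectureFor_powSucc_of_isOfCMType_of_threePerField_of_markman (hW4 : Markman2025_weilClasses_algebraic_abelianFourfold)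
    (hcm : IsOfCMType X) (h3 : ∀ B : AbelianVariety ℂ, B.IsSimple → AVDominatedBy B X → B.dim ≤ 3)
    (hT : ∀ B₀ B₁ : AbelianVariety ℂ, B₀.IsSimple → B₁.IsSimple → AVDominatedBy B₀ X → AVDominatedBy B₁ X → B₀.dim = 3 → B₁.dim = 3 → ¬ IsIsogenous B₀ B₁ →
      ∀ (K₀ : Type) [Field K₀] [NumberField K₀] [IsCMField K₀] (Φ₀ : CMType K₀) (ι₀ : 𝓞 K₀ →+* End B₀) (θ₀ : K₀ →+* Module.End ℂ (complexBetti B₀.X 1))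
        (K₁ : Type) [Field K₁] [NumberField K₁] [IsCMField K₁] (Φ₁ : CMType K₁) (ι₁ : 𝓞 K₁ →+* End B₁) (θ₁ : K₁ →+* Module.End ℂ (complexBetti B₁.X 1)),
        IsCMTypeRealisation Φ₀ B₀ ι₀ θ₀ → IsCMTypeRealisation Φ₁ B₁ ι₁ θ₁ →
          ((∃ F : IntermediateField ℚ K₀, Module.finrank ℚ F = 2 ∧ IsTotallyComplex F ∧ Nonempty (F →+* K₁)) → normalClosure ℚ K₀ ℂ ≠ normalClosure ℚ K₁ ℂ))
    (hT4 : ∀ B₀ B₁ B₂ B₃ : AbelianVariety ℂ, B₀.IsSimple → B₁.IsSimple → B₂.IsSimple → B₃.IsSimple →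
      AVDominatedBy B₀ X → AVDominatedBy B₁ X → AVDominatedBy B₂ X → AVDominatedBy B₃ X → B₀.dim = 3 → B₁.dim = 3 → B₂.dim = 3 → B₃.dim = 3 →
      ¬ IsIsogenous B₀ B₁ → ¬ IsIsogenous B₀ B₂ → ¬ IsIsogenous B₀ B₃ → ¬ IsIsogenous B₁ B₂ → ¬ IsIsogenous B₁ B₃ → ¬ IsIsogenous B₂ B₃ →
      ∀ (K₀ : Type) [Field K₀] [NumberField K₀] [IsCMField K₀] (Φ₀ : CMType K₀) (ι₀ : 𝓞 K₀ →+* End B₀) (θ₀ : K₀ →+* Module.End ℂ (complexBetti B₀.X 1))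
        (K₁ : Type) [Field K₁] [NumberField K₁] [IsCMField K₁] (Φ₁ : CMType K₁) (ι₁ : 𝓞 K₁ →+* End B₁) (θ₁ : K₁ →+* Module.End ℂ (complexBetti B₁.X 1))
        (K₂ : Type) [Field K₂] [NumberField K₂] [IsCMField K₂] (Φ₂ : CMType K₂) (ι₂ : 𝓞 K₂ →+* End B₂) (θ₂ : K₂ →+* Module.End ℂ (complexBetti B₂.X 1))
        (K₃ : Type) [Field K₃] [NumberField K₃] [IsCMField K₃] (Φ₃ : CMType K₃) (ι₃ : 𝓞 K₃ →+* End B₃) (θ₃ : K₃ →+* Module.End ℂ (complexBetti B₃.X 1)),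
        IsCMTypeRealisation Φ₀ B₀ ι₀ θ₀ → IsCMTypeRealisation Φ₁ B₁ ι₁ θ₁ → IsCMTypeRealisation Φ₂ B₂ ι₂ θ₂ → IsCMTypeRealisation Φ₃ B₃ ι₃ θ₃ →
          ¬ (Nonempty (K₁ ≃+* K₀) ∧ Nonempty (K₂ ≃+* K₀) ∧ Nonempty (K₃ ≃+* K₀)))
    (hS : ∀ B₀ B₁ B₂ : AbelianVariety ℂ, B₀.IsSimple → B₁.IsSimple → B₂.IsSimple → AVDominatedBy B₀ X → AVDominatedBy B₁ X → AVDominatedBy B₂ X →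
      B₀.dim = 2 → B₁.dim = 2 → B₂.dim = 2 → ¬ IsIsogenous B₀ B₁ → ¬ IsIsogenous B₀ B₂ → ¬ IsIsogenous B₁ B₂ →
      ∀ (K₀ : Type) [Field K₀] [NumberField K₀] [IsCMField K₀] (Φ₀ : CMType K₀) (ι₀ : 𝓞 K₀ →+* End B₀) (θ₀ : K₀ →+* Module.End ℂ (complexBetti B₀.X 1))
        (K₁ : Type) [Field K₁] [NumberField K₁] [IsCMField K₁] (Φ₁ : CMType K₁) (ι₁ : 𝓞 K₁ →+* End B₁) (θ₁ : K₁ →+* Module.End ℂ (complexBetti B₁.X 1))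
        (K₂ : Type) [Field K₂] [NumberField K₂] [IsCMField K₂] (Φ₂ : CMType K₂) (ι₂ : 𝓞 K₂ →+* End B₂) (θ₂ : K₂ →+* Module.End ℂ (complexBetti B₂.X 1)),
        IsCMTypeRealisation Φ₀ B₀ ι₀ θ₀ → IsCMTypeRealisation Φ₁ B₁ ι₁ θ₁ → IsCMTypeRealisation Φ₂ B₂ ι₂ θ₂ →
          ¬ (normalClosure ℚ K₀ ℂ = normalClosure ℚ K₁ ℂ ∧ normalClosure ℚ K₁ ℂ = normalClosure ℚ K₂ ℂ))
    (N : ℕ) : HodgeConjectureFor (X.powSucc N).dim (X.powSucc N).X :=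
  hodgeConjectureFor_of_avDominatedBy_powSucc_of_isOfCMType_of_threePerField_of_markman hW4 hcm h3 hT hT4 hS (AVDominatedBy.refl _)

/-! ## §2 The witnessed form: hypotheses checked on one CM realisation per factor -/

/-- **MAIN THEOREM (on the variety, witnessed).**  `X` of CM type; (a) simple isogeny factors of dimension `≤ 3`; (b) for any two NON-isogenous simple threefold factors
there EXIST CM realisations `B₀ ⊨ (K₀; Φ₀)`, `B₁ ⊨ (K₁; Φ₁)` with: a totally complex quadratic `F ≤ K₀` embedding in `K₁` forces `L(K₀) ≠ L(K₁)`; (b″) for any four pairwise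
non-isogenous simple threefold factors there EXIST CM realisations whose fields are not all isomorphic to the first; (c) for any three pairwise non-isogenous simple surface factors
there EXIST CM realisations whose fields do not share one Galois closure.  Then everything
dominated by a power `X^{N+1}` satisfies the Hodge conjecture, given ONLY Markman's fourfold theorem (the CM field of a simple CM abelian variety is unique up to isomorphism,
and (b), (b″), (c) transport along field isomorphisms).  `HC_CM` is NOT asserted. [cite: MilneCM2006, Ch. I Prop. 3.13] [cite: Milne1999LefschetzClasses, §1 Prop. 1.1]
[cite: MoonenZarhin1999LowDim, Thm. (0.1), (0.2), §3 (3.1), Cor. (3.9)] [cite: Markman2025SurveySecant, Thm. 1.2] -/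
theorem hodgeConjectureFor_of_avDominatedBy_powSucc_of_isOfCMType_of_witnessed_threePerField_of_markman
    (hW4 : Markman2025_weilClasses_algebraic_abelianFourfold) (hcm : IsOfCMType X)
    (h3 : ∀ B : AbelianVariety ℂ, B.IsSimple → AVDominatedBy B X → B.dim ≤ 3)
    (hT : ∀ B₀ B₁ : AbelianVariety ℂ, B₀.IsSimple → B₁.IsSimple → AVDominatedBy B₀ X → AVDominatedBy B₁ X → B₀.dim = 3 → B₁.dim = 3 → ¬ IsIsogenous B₀ B₁ →
      ∃ (K₀ : Type) (_ : Field K₀) (_ : NumberField K₀) (_ : IsCMField K₀) (Φ₀ : CMType K₀) (ι₀ : 𝓞 K₀ →+* End B₀) (θ₀ : K₀ →+* Module.End ℂ (complexBetti B₀.X 1))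
        (K₁ : Type) (_ : Field K₁) (_ : NumberField K₁) (_ : IsCMField K₁) (Φ₁ : CMType K₁) (ι₁ : 𝓞 K₁ →+* End B₁) (θ₁ : K₁ →+* Module.End ℂ (complexBetti B₁.X 1)),
        IsCMTypeRealisation Φ₀ B₀ ι₀ θ₀ ∧ IsCMTypeRealisation Φ₁ B₁ ι₁ θ₁ ∧
          ((∃ F : IntermediateField ℚ K₀, Module.finrank ℚ F = 2 ∧ IsTotallyComplex F ∧ Nonempty (F →+* K₁)) → normalClosure ℚ K₀ ℂ ≠ normalClosure ℚ K₁ ℂ))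
    (hT4 : ∀ B₀ B₁ B₂ B₃ : AbelianVariety ℂ, B₀.IsSimple → B₁.IsSimple → B₂.IsSimple → B₃.IsSimple →
      AVDominatedBy B₀ X → AVDominatedBy B₁ X → AVDominatedBy B₂ X → AVDominatedBy B₃ X → B₀.dim = 3 → B₁.dim = 3 → B₂.dim = 3 → B₃.dim = 3 →
      ¬ IsIsogenous B₀ B₁ → ¬ IsIsogenous B₀ B₂ → ¬ IsIsogenous B₀ B₃ → ¬ IsIsogenous B₁ B₂ → ¬ IsIsogenous B₁ B₃ → ¬ IsIsogenous B₂ B₃ →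
      ∃ (K₀ : Type) (_ : Field K₀) (_ : NumberField K₀) (_ : IsCMField K₀) (Φ₀ : CMType K₀) (ι₀ : 𝓞 K₀ →+* End B₀) (θ₀ : K₀ →+* Module.End ℂ (complexBetti B₀.X 1))
        (K₁ : Type) (_ : Field K₁) (_ : NumberField K₁) (_ : IsCMField K₁) (Φ₁ : CMType K₁) (ι₁ : 𝓞 K₁ →+* End B₁) (θ₁ : K₁ →+* Module.End ℂ (complexBetti B₁.X 1))
        (K₂ : Type) (_ : Field K₂) (_ : NumberField K₂) (_ : IsCMField K₂) (Φ₂ : CMType K₂) (ι₂ : 𝓞 K₂ →+* End B₂) (θ₂ : K₂ →+* Module.End ℂ (complexBetti B₂.X 1))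
        (K₃ : Type) (_ : Field K₃) (_ : NumberField K₃) (_ : IsCMField K₃) (Φ₃ : CMType K₃) (ι₃ : 𝓞 K₃ →+* End B₃) (θ₃ : K₃ →+* Module.End ℂ (complexBetti B₃.X 1)),
        IsCMTypeRealisation Φ₀ B₀ ι₀ θ₀ ∧ IsCMTypeRealisation Φ₁ B₁ ι₁ θ₁ ∧ IsCMTypeRealisation Φ₂ B₂ ι₂ θ₂ ∧ IsCMTypeRealisation Φ₃ B₃ ι₃ θ₃ ∧
          ¬ (Nonempty (K₁ ≃+* K₀) ∧ Nonempty (K₂ ≃+* K₀) ∧ Nonempty (K₃ ≃+* K₀)))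
    (hS : ∀ B₀ B₁ B₂ : AbelianVariety ℂ, B₀.IsSimple → B₁.IsSimple → B₂.IsSimple → AVDominatedBy B₀ X → AVDominatedBy B₁ X → AVDominatedBy B₂ X →
      B₀.dim = 2 → B₁.dim = 2 → B₂.dim = 2 → ¬ IsIsogenous B₀ B₁ → ¬ IsIsogenous B₀ B₂ → ¬ IsIsogenous B₁ B₂ →
      ∃ (K₀ : Type) (_ : Field K₀) (_ : NumberField K₀) (_ : IsCMField K₀) (Φ₀ : CMType K₀) (ι₀ : 𝓞 K₀ →+* End B₀) (θ₀ : K₀ →+* Module.End ℂ (complexBetti B₀.X 1))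
        (K₁ : Type) (_ : Field K₁) (_ : NumberField K₁) (_ : IsCMField K₁) (Φ₁ : CMType K₁) (ι₁ : 𝓞 K₁ →+* End B₁) (θ₁ : K₁ →+* Module.End ℂ (complexBetti B₁.X 1))
        (K₂ : Type) (_ : Field K₂) (_ : NumberField K₂) (_ : IsCMField K₂) (Φ₂ : CMType K₂) (ι₂ : 𝓞 K₂ →+* End B₂) (θ₂ : K₂ →+* Module.End ℂ (complexBetti B₂.X 1)),
        IsCMTypeRealisation Φ₀ B₀ ι₀ θ₀ ∧ IsCMTypeRealisation Φ₁ B₁ ι₁ θ₁ ∧ IsCMTypeRealisation Φ₂ B₂ ι₂ θ₂ ∧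
          ¬ (normalClosure ℚ K₀ ℂ = normalClosure ℚ K₁ ℂ ∧ normalClosure ℚ K₁ ℂ = normalClosure ℚ K₂ ℂ))
    {B : AbelianVariety ℂ} {N : ℕ} (hB : AVDominatedBy B (X.powSucc N)) : HodgeConjectureFor B.dim B.X := by
  refine hodgeConjectureFor_of_avDominatedBy_powSucc_of_isOfCMType_of_threePerField_of_markman hW4 hcm h3 ?_ ?_ ?_ hB
  · intro B₀ B₁ hs₀ hs₁ hd₀ hd₁ h3₀ h3₁ hni K₀ _ _ _ Φ₀ ι₀ θ₀ K₁ _ _ _ Φ₁ ι₁ θ₁ hA₀ hA₁ h hL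
    obtain ⟨K₀', _, _, _, Φ₀', ι₀', θ₀', K₁', _, _, _, Φ₁', ι₁', θ₁', hA₀', hA₁', hQ1⟩ := hT B₀ B₁ hs₀ hs₁ hd₀ hd₁ h3₀ h3₁ hni
    obtain ⟨ε₀, -⟩ := exists_ringEquiv_forall_mem_iff_of_isIsogenous hA₀ hA₀' hs₀ (IsIsogenous.refl _)
    obtain ⟨ε₁, -⟩ := exists_ringEquiv_forall_mem_iff_of_isIsogenous hA₁ hA₁' hs₁ (IsIsogenous.refl _)
    refine hQ1 (exists_quadratic_subfield_of_ringEquiv ε₀ ε₁ h) ?_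
    rw [← normalClosure_eq_of_ringEquiv ε₀, ← normalClosure_eq_of_ringEquiv ε₁, hL]
  · intro B₀ B₁ B₂ B₃ hs₀ hs₁ hs₂ hs₃ hd₀ hd₁ hd₂ hd₃ h3₀ h3₁ h3₂ h3₃ hn₀₁ hn₀₂ hn₀₃ hn₁₂ hn₁₃ hn₂₃ K₀ _ _ _ Φ₀ ι₀ θ₀ K₁ _ _ _ Φ₁ ι₁ θ₁ K₂ _ _ _ Φ₂ ι₂ θ₂
      K₃ _ _ _ Φ₃ ι₃ θ₃ hA₀ hA₁ hA₂ hA₃ h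
    obtain ⟨K₀', _, _, _, Φ₀', ι₀', θ₀', K₁', _, _, _, Φ₁', ι₁', θ₁', K₂', _, _, _, Φ₂', ι₂', θ₂', K₃', _, _, _, Φ₃', ι₃', θ₃', hA₀', hA₁', hA₂', hA₃', hL⟩ :=
      hT4 B₀ B₁ B₂ B₃ hs₀ hs₁ hs₂ hs₃ hd₀ hd₁ hd₂ hd₃ h3₀ h3₁ h3₂ h3₃ hn₀₁ hn₀₂ hn₀₃ hn₁₂ hn₁₃ hn₂₃
    obtain ⟨ε₀, -⟩ := exists_ringEquiv_forall_mem_iff_of_isIsogenous hA₀ hA₀' hs₀ (IsIsogenous.refl _)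
    obtain ⟨ε₁, -⟩ := exists_ringEquiv_forall_mem_iff_of_isIsogenous hA₁ hA₁' hs₁ (IsIsogenous.refl _)
    obtain ⟨ε₂, -⟩ := exists_ringEquiv_forall_mem_iff_of_isIsogenous hA₂ hA₂' hs₂ (IsIsogenous.refl _)
    obtain ⟨ε₃, -⟩ := exists_ringEquiv_forall_mem_iff_of_isIsogenous hA₃ hA₃' hs₃ (IsIsogenous.refl _)
    obtain ⟨⟨e₁⟩, ⟨e₂⟩, ⟨e₃⟩⟩ := h
    exact hL ⟨⟨ε₁.symm.trans (e₁.trans ε₀)⟩, ⟨ε₂.symm.trans (e₂.trans ε₀)⟩, ⟨ε₃.symm.trans (e₃.trans ε₀)⟩⟩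
  · intro B₀ B₁ B₂ hs₀ hs₁ hs₂ hd₀ hd₁ hd₂ h2₀ h2₁ h2₂ hn₀₁ hn₀₂ hn₁₂ K₀ _ _ _ Φ₀ ι₀ θ₀ K₁ _ _ _ Φ₁ ι₁ θ₁ K₂ _ _ _ Φ₂ ι₂ θ₂ hA₀ hA₁ hA₂ h
    obtain ⟨K₀', _, _, _, Φ₀', ι₀', θ₀', K₁', _, _, _, Φ₁', ι₁', θ₁', K₂', _, _, _, Φ₂', ι₂', θ₂', hA₀', hA₁', hA₂', hL⟩ :=
      hS B₀ B₁ B₂ hs₀ hs₁ hs₂ hd₀ hd₁ hd₂ h2₀ h2₁ h2₂ hn₀₁ hn₀₂ hn₁₂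
    obtain ⟨ε₀, -⟩ := exists_ringEquiv_forall_mem_iff_of_isIsogenous hA₀ hA₀' hs₀ (IsIsogenous.refl _)
    obtain ⟨ε₁, -⟩ := exists_ringEquiv_forall_mem_iff_of_isIsogenous hA₁ hA₁' hs₁ (IsIsogenous.refl _)
    obtain ⟨ε₂, -⟩ := exists_ringEquiv_forall_mem_iff_of_isIsogenous hA₂ hA₂' hs₂ (IsIsogenous.refl _)
    apply hL
    rw [← normalClosure_eq_of_ringEquiv ε₀, ← normalClosure_eq_of_ringEquiv ε₁, ← normalClosure_eq_of_ringEquiv ε₂]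
    exact h

end OnTheVariety

end Summit.HodgeConjecture.CorCM.MultiFieldWeil

end
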